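import Summits.QuantumFields.YangMills.Theorems.BalabanUVNodesN14ConvexFibreCauchy
import Summits.QuantumFields.YangMills.Theorems.BalabanUVNodesN14VarianceInfluence
import Literature.MathematicalPhysics.QuantumLattice.WilsonFeynmanHellmann
import Mathlib.MeasureTheory.Function.ConditionalExpectation.PullOut

/-!
# BalabanUVNodes ∕ node N14 = NE1′ — THE LAW CHANNEL (LENS control v4.0 CARD 10, row s11): at the fibre-blind observables of record the binder is the two-run LAW
# matching of push-forwards; by Feynman–Hellmann interpolation it is bounded by the interpolated COVARIANCES of the observable with the one-step log-density
# defect `D`, which see `D` only through its CONDITIONAL EXPECTATION given the unit field — so the T⁴ Cauchy property on the template follows from ONE summable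
# scalar family: the L¹-oscillation of the conditioned (flowed) one-step defect

Cell `pub-ymgap`, HUMAN RULING D-0062 (Track A at full width), seat `pub-ymgap-dag-n14-c` (R134 ACCELERATION, strategy s1), generation 5;
route `Summits/QuantumFields/YangMills/Theses/BalabanUVNodes.lean` rev 16∕17 (cluster K3‴ `SpineGivenEndpointR13` = stmt-QuantumFields-19912,
`--supports … --as helper`); venue ruling R424 (`YangMills/Theorems`, namespace `YMDAG.N14.LawChannel`).  ADDITIVE — imports K (`…ConvexFibreCauchy`), the tree's
`Literature/MathematicalPhysics/QuantumLattice/WilsonFeynmanHellmann` (`hasDerivAt_integral_tilted_eq_covariance`, `integrableExpSet_eq_univ_of_abs_le` — PROVED there)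
and Mathlib's conditional-expectation pull-out, plus this lineage's g3 `…N14VarianceInfluence` (`tilted_prod_add`, CITED in §4); THEOREMS ONLY (0 `def`), modifies nothing.

SOURCE OF RECORD.  LENS control v4.0 (planner seat `ym-lens-BalabanUVNodes-control` g4, memo `LENS-control.md` v4.0 94b531ba4cf66ab7, farm-checked sketch
`Sketch-control-g4.lean` c13801b63e12022c §7, pub-ymgap INBOX 2026-08-27T04:26Z; memo only, nothing filed; row s11 «N14 successor: instantiate
`tiltedMeanMatching_of_lawChannel` on K's template tower»).  §1 below LIFTS the sketch's §7 CARD 10 lemmas VERBATIM WITH CREDIT; §2 is this seat's instantiation on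
file K's whole-measure tower.  Read together with `…N14ConvexFibreAtRecordObservables` (LENS decomp v6 ROW CS-X: the engine of files A–L is idle at the record).

WHAT THIS IS.
* §1 [folklore; LENS control g4 sketch §7, credited] `isProbabilityMeasure_tilted_of_abs_le`, **`tiltedMeanMatching_fibreBlind_iff`** ((OBS): a fibre-blind observable
  `F K ∘ π K` turns `TiltedMeanMatching` into law matching of the push-forwards `(ν′ K τ).map (π K)`), ★ **`abs_tiltedMean_tilted_sub_le_of_cov`** (CARD 10: for bounded
  measurable `F`, `D` on a probability space, `|tiltedMean F (μ.tilted D) s − tiltedMean F μ s| ≤ sup_{u∈[0,1]} |Cov_{μ.tilted (sF + uD)}(F, D)|` — Feynman–Hellmann along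
  `u ↦ μ.tilted (sF + uD)`, the tree's `WilsonFeynmanHellmann.hasDerivAt_integral_tilted_eq_covariance` + Mathlib `tilted_tilted` + the mean value inequality),
  ★ **`abs_cov_le_of_condExp`** (tower property: `F` measurable for a sub-σ-algebra `m`, `|F| ≤ B₀` ⇒ `|Cov_μ(F, D)| ≤ B₀·∫|μ[D|m] − μ[D]| dμ` — the covariance sees the
  one-step defect only through its conditional expectation given the unit field), **`tiltedMeanMatching_of_lawChannel`** (the class-indexed binder from ONE scalar family).
* §2 [folklore ∘ §1 + K] THE INSTANTIATION ON K's TOWER (this seat): `abs_tiltedMean_succ_sub_le_of_lawChannel` (run `K+1`'s law pushes forward along the first averaging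
  `π K` to `(μ K).tilted (D K)`, observables `F (K+1) = F K ∘ π K` ⇒ one-step matching `≤ η K` from the interpolated covariance bound), ★ **`matchingModConstants_of_lawChannelTower`**,
  ★ **`cauchySeq_genFun_of_lawChannelTower`** (`Σ η K < ∞` ⇒ Cauchy generating functions), and the CONDITIONED form ★★ **`cauchySeq_genFun_of_condDefectTower`**: with
  `F K` measurable for the unit-field σ-algebra `m K` and `b K ≥ ∫|μ_{u,s}[D K | m K] − μ_{u,s}[D K]| dμ_{u,s}` for every interpolated law `μ_{u,s} = (μ K).tilted (s·F K + u·D K)`,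
  `|s| ≤ l₀`, `u ∈ [0,1]`: `Σ b K < ∞` ⇒ Cauchy — N14's located input RE-POINTED to (F2′) «the summable L¹-oscillation of the conditioned one-step defect» (annealed
  irrelevance; NOT PRINTED for YM₄; produced by nobody).
* §4 [folklore] THE PRODUCT CARICATURE OF F2 ⇒ (F2′) (g3's `VarianceInfluence.tilted_prod_add` — the tilt of a product by a separable exponent is the product of the tilts — CITED), `tiltedMean_comp_fst_prod`,
  ★ **`abs_tiltedMean_prodTilted_sub_le_of_baseDefect`** — when the unit field is INDEPENDENT of the fluctuations and the defect SPLITS as `dU ⊕ dV`, the binder is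
  `≤ B₀(e^{2 sup|dU|} − 1)`: the fluctuation-supported part `dV` of the defect, however extensive, is INVISIBLE to a fibre-blind observable (cross terms ⇒ §3's conditioned form).

WHAT THIS IS NOT.  Everything here is PROVED (0 `sorry`, 0 named facts).  The one-step log-density defect `D K` of Bałaban's runs on run `K`'s coordinates, its
boundedness class, and the smallness of its conditioned oscillation are NODE O ∕ NE5–NE7 objects and estimates — HYPOTHESES here; nothing of Bałaban's
instantiated; N14 NOT discharged; count-neutral.  One finite four-torus programme at fixed ε; NOT ℝ⁴, NOT OS, NOT a mass gap, NOT Clay.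
-/

noncomputable section

namespace YMDAG.N14.LawChannel

open MeasureTheory ProbabilityTheory Set Filter Topology
open scoped ENNReal NNReal
open Literature.MathematicalPhysics.QuantumLattice (hasDerivAt_integral_tilted_eq_covariance integrableExpSet_eq_univ_of_abs_le)
open Literature.MathematicalPhysics.QuantumFieldTheory.Balaban1983to89.T4CauchySum (MatchingModConstants genFun cauchySeq_genFun)
open Summit.QuantumFields.BalabanUV.T4Continuum.NE1p.DressedMGFForm (tiltedMean TiltedMeanMatching matchingModConstants_of_tiltedMeans)
open YMDAG.N14.ConvexFibreCauchy (tiltedMean_map)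

/-! ## §1 CARD 10 of LENS control g4 (lifted with credit): fibre-blind ⇒ law matching; Feynman–Hellmann; the conditioned defect -/
section Card10

variable {Ω : Type*} [MeasurableSpace Ω]

/-- A bounded tilt of a probability law is a probability law. [folklore; LENS control g4 sketch §2] -/
theorem isProbabilityMeasure_tilted_of_abs_le {ν : Measure Ω} [IsProbabilityMeasure ν] {Λ : Ω → ℝ} {C : ℝ} (hΛm : Measurable Λ)
    (hΛb : ∀ b, |Λ b| ≤ C) : IsProbabilityMeasure (ν.tilted Λ) := by
  have h := Literature.Probability.Moments.integrable_exp_mul_of_abs_le_const ν hΛm hΛb 1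
  simp only [one_mul] at h
  exact isProbabilityMeasure_tilted h

variable {ι : Type*} [DecidableEq ι] {ΩA ΩB : ℕ → Type*} [∀ K, MeasurableSpace (ΩA K)] [∀ K, MeasurableSpace (ΩB K)]

/-- **(OBS) A FIBRE-BLIND OBSERVABLE TURNS `TiltedMeanMatching` INTO LAW MATCHING** [folklore; LENS control g4 sketch §7]: if run B's observable is `F K ∘ π K` for
measurable maps `π K : Ω_B K → Ω_A K` onto run A's coordinates (the observable of record `W_C ∘ avg^{K+1} = (W_C ∘ avg^K) ∘ avg`), then the binder compares the tilted
means of the SAME `F K` under run A's class law and under the PUSH-FORWARD of run B's class law (K §1 `tiltedMean_map`). -/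
theorem tiltedMeanMatching_fibreBlind_iff {l₀ : ℝ} {T : ℕ → Finset ι} {Bad : ℕ → ℝ → Finset ι}
    {F : ∀ K, ΩA K → ℝ} {ν : ∀ K, ι → Measure (ΩA K)} {ν' : ∀ K, ι → Measure (ΩB K)} {π : ∀ K, ΩB K → ΩA K}
    (hπ : ∀ K, Measurable (π K)) (hF : ∀ K, Measurable (F K)) {η : ℕ → ℝ} :
    TiltedMeanMatching l₀ T Bad F ν (fun K ω => F K (π K ω)) ν' η ↔
      TiltedMeanMatching l₀ T Bad F ν F (fun K τ => (ν' K τ).map (π K)) η := by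
  unfold TiltedMeanMatching
  have h : ∀ K τ s, tiltedMean (fun ω => F K (π K ω)) (ν' K τ) s = tiltedMean (F K) ((ν' K τ).map (π K)) s := fun K τ s =>
    (tiltedMean_map (hπ K) (hF K) s).symm
  simp_rw [h]

variable {μ : Measure Ω} [IsProbabilityMeasure μ] {F D : Ω → ℝ} {B₀ CD s : ℝ}

/-- **CARD 10 — THE LAW CHANNEL BY FEYNMAN–HELLMANN INTERPOLATION** [folklore ∘ tree `WilsonFeynmanHellmann`; LENS control g4 sketch §7]: for bounded measurable `F`, `D`
on a probability space, interpolating run A's law `μ` to run B's push-forward `μ.tilted D` along `u ↦ μ.tilted (sF + uD)`,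
`|tiltedMean F (μ.tilted D) s − tiltedMean F μ s| ≤ sup_{u ∈ [0,1]} |Cov_{μ.tilted (sF + uD)}(F, D)|`. -/
theorem abs_tiltedMean_tilted_sub_le_of_cov (hFm : Measurable F) (hFb : ∀ x, |F x| ≤ B₀) (hDm : Measurable D)
    (hDb : ∀ x, |D x| ≤ CD) {c : ℝ}
    (hc : ∀ u ∈ Set.Icc (0 : ℝ) 1, |cov[F, D; μ.tilted fun x => s * F x + u * D x]| ≤ c) :
    |tiltedMean F (μ.tilted D) s - tiltedMean F μ s| ≤ c := by
  set μs : Measure Ω := μ.tilted fun x => s * F x with hμs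
  haveI : IsProbabilityMeasure μs :=
    isProbabilityMeasure_tilted_of_abs_le (ν := μ) (C := |s| * B₀) (measurable_const.mul hFm) fun x => by
      rw [abs_mul]; exact mul_le_mul_of_nonneg_left (hFb x) (abs_nonneg s)
  have hexpF : Integrable (fun x => Real.exp (s * F x)) μ :=
    Literature.Probability.Moments.integrable_exp_mul_of_abs_le_const μ hFm hFb s
  have hexpD : Integrable (fun x => Real.exp (D x)) μ := by
    have := Literature.Probability.Moments.integrable_exp_mul_of_abs_le_const μ hDm hDb 1; simpa using this
  have hφ : ∀ u : ℝ, HasDerivAt (fun u : ℝ => ∫ x, F x ∂(μs.tilted fun x => u * D x))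
      (cov[F, D; μs.tilted fun x => u * D x]) u := fun u => by
    have hint : u ∈ interior (integrableExpSet D μs) := by
      rw [integrableExpSet_eq_univ_of_abs_le (μ := μs) hDm.aemeasurable (Eventually.of_forall hDb), interior_univ]
      trivial
    exact hasDerivAt_integral_tilted_eq_covariance hint hFm.aestronglyMeasurable
      (Eventually.of_forall fun x => by rw [Real.norm_eq_abs]; exact hFb x)
  have htt : ∀ u : ℝ, μs.tilted (fun x => u * D x) = μ.tilted fun x => s * F x + u * D x := fun u => by
    rw [hμs, tilted_tilted hexpF]; rfl
  have h1 : tiltedMean F (μ.tilted D) s = ∫ x, F x ∂(μs.tilted fun x => (1 : ℝ) * D x) := by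
    rw [htt 1]
    unfold tiltedMean
    rw [tilted_tilted hexpD]
    congr 2
    ext x
    simp only [Pi.add_apply, one_mul]
    ring
  have h0 : tiltedMean F μ s = ∫ x, F x ∂(μs.tilted fun x => (0 : ℝ) * D x) := by
    have : μs.tilted (fun x => (0 : ℝ) * D x) = μs := by simp only [zero_mul]; exact tilted_zero μs
    rw [this, hμs]; rfl
  have key := norm_image_sub_le_of_norm_deriv_le_segment_01'
    (f := fun u : ℝ => ∫ x, F x ∂(μs.tilted fun x => u * D x))
    (fun u _ => (hφ u).hasDerivWithinAt)
    (fun u hu => by rw [Real.norm_eq_abs, htt u]; exact hc u (Set.Ico_subset_Icc_self hu))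
  rw [h1, h0, ← Real.norm_eq_abs]
  exact key

/-- **ONLY THE CONDITIONED (FLOWED) DEFECT IS SEEN** [folklore: tower property; LENS control g4 sketch §7]: if `F` is measurable for a sub-σ-algebra `m` (the unit-scale
field's) and bounded by `B₀`, then for bounded measurable `D`, `|Cov_μ(F, D)| ≤ B₀ · ∫ |μ[D | m] − μ[D]| dμ` — the covariance of CARD 10 sees the one-step defect `D` only
through its conditional expectation given the unit field (its image under the `K` common renormalisation steps). -/
theorem abs_cov_le_of_condExp {Ω : Type*} {m m₀ : MeasurableSpace Ω} {μ : Measure Ω} [IsProbabilityMeasure μ]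
    (hm : m ≤ m₀) {F D : Ω → ℝ} {B₀ CD : ℝ} (hFm : StronglyMeasurable[m] F) (hFb : ∀ x, |F x| ≤ B₀)
    (hDm : Measurable D) (hDb : ∀ x, |D x| ≤ CD) :
    |cov[F, D; μ]| ≤ B₀ * ∫ x, |(μ[D|m]) x - ∫ y, D y ∂μ| ∂μ := by
  have hFm₀ : StronglyMeasurable F := hFm.mono hm
  have hFi : Integrable F μ := (integrable_const B₀).mono' hFm₀.aestronglyMeasurable
    (Eventually.of_forall fun x => by rw [Real.norm_eq_abs]; exact hFb x)
  have hDi : Integrable D μ := (integrable_const CD).mono' hDm.aestronglyMeasurable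
    (Eventually.of_forall fun x => by rw [Real.norm_eq_abs]; exact hDb x)
  have hFDi : Integrable (F * D) μ := by
    refine (integrable_const (B₀ * CD)).mono' (hFm₀.aestronglyMeasurable.mul hDm.aestronglyMeasurable)
      (Eventually.of_forall fun x => ?_)
    rw [Real.norm_eq_abs, Pi.mul_apply, abs_mul]
    exact mul_le_mul (hFb x) (hDb x) (abs_nonneg _) ((abs_nonneg _).trans (hFb x))
  have hB₀ : 0 ≤ B₀ := by
    obtain ⟨x⟩ := nonempty_of_measure_ne_zero (μ := μ) (s := Set.univ) (by simp)
    exact (abs_nonneg _).trans (hFb x)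
  -- the pull-out property: ∫ F·D = ∫ F·μ[D|m]
  have hpull : ∫ x, F x * D x ∂μ = ∫ x, F x * (μ[D|m]) x ∂μ := by
    have hae : μ[F * D|m] =ᵐ[μ] F * μ[D|m] := condExp_mul_of_stronglyMeasurable_left hFm hFDi hDi
    calc ∫ x, F x * D x ∂μ = ∫ x, (F * D) x ∂μ := rfl
      _ = ∫ x, (μ[F * D|m]) x ∂μ := (integral_condExp hm).symm
      _ = ∫ x, (F * μ[D|m]) x ∂μ := integral_congr_ae hae
      _ = ∫ x, F x * (μ[D|m]) x ∂μ := rfl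
  have hcondi : Integrable (μ[D|m]) μ := integrable_condExp
  set c₀ : ℝ := ∫ y, D y ∂μ with hc₀
  have hFb' : ∀ᵐ x ∂μ, ‖F x‖ ≤ B₀ := Eventually.of_forall fun x => by rw [Real.norm_eq_abs]; exact hFb x
  have hFcond : Integrable (fun x => F x * (μ[D|m]) x) μ := hcondi.bdd_mul hFm₀.aestronglyMeasurable hFb'
  have hGi : Integrable (fun x => (μ[D|m]) x - c₀) μ := hcondi.sub (integrable_const c₀)
  have hFG : Integrable (fun x => F x * ((μ[D|m]) x - c₀)) μ := hGi.bdd_mul hFm₀.aestronglyMeasurable hFb'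
  have hcov : cov[F, D; μ] = ∫ x, F x * ((μ[D|m]) x - c₀) ∂μ := by
    rw [covariance_eq_sub (MemLp.of_bound hFm₀.aestronglyMeasurable B₀ hFb')
      (MemLp.of_bound hDm.aestronglyMeasurable CD (Eventually.of_forall fun x => by rw [Real.norm_eq_abs]; exact hDb x))]
    have hsplit : ∫ x, F x * ((μ[D|m]) x - c₀) ∂μ = ∫ x, F x * (μ[D|m]) x ∂μ - (∫ x, F x ∂μ) * c₀ := by
      have : (fun x => F x * ((μ[D|m]) x - c₀)) = fun x => F x * (μ[D|m]) x - F x * c₀ := by ext x; ring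
      rw [this, integral_sub hFcond (hFi.mul_const c₀), integral_mul_const]
    rw [hsplit, ← hpull]
    rfl
  rw [hcov]
  calc |∫ x, F x * ((μ[D|m]) x - c₀) ∂μ| ≤ ∫ x, |F x * ((μ[D|m]) x - c₀)| ∂μ := abs_integral_le_integral_abs
    _ ≤ ∫ x, B₀ * |(μ[D|m]) x - c₀| ∂μ := by
        refine integral_mono_of_nonneg (Eventually.of_forall fun x => abs_nonneg _) (hGi.abs.const_mul B₀)
          (Eventually.of_forall fun x => ?_)
        show |F x * ((μ[D|m]) x - c₀)| ≤ B₀ * |(μ[D|m]) x - c₀|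
        rw [abs_mul]
        exact mul_le_mul_of_nonneg_right (hFb x) (abs_nonneg _)
    _ = B₀ * ∫ x, |(μ[D|m]) x - c₀| ∂μ := integral_const_mul _ _

/-- **CARD 10 AT BINDER LEVEL — `TiltedMeanMatching` FROM THE LAW CHANNEL** [folklore; LENS control g4 sketch §7]: with a fibre-blind observable `F′ K = F K ∘ π K`, run B's
class laws pushing forward to `(ν K τ).tilted (D K τ)` (`D` = the performed one-step log-density defect on run A's coordinates) and probability class laws, the residual
binder of record follows from ONE scalar family: the interpolated covariances `|Cov_{(ν K τ).tilted (s·F K + u·D K τ)}(F K, D K τ)| ≤ η K`, `u ∈ [0,1]`, `|s| ≤ l₀`, good `τ`. -/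
theorem tiltedMeanMatching_of_lawChannel {l₀ : ℝ} {T : ℕ → Finset ι} {Bad : ℕ → ℝ → Finset ι}
    {F : ∀ K, ΩA K → ℝ} {ν : ∀ K, ι → Measure (ΩA K)} {ν' : ∀ K, ι → Measure (ΩB K)} {π : ∀ K, ΩB K → ΩA K}
    (hπ : ∀ K, Measurable (π K)) (hF : ∀ K, Measurable (F K)) {B₀ : ℝ} (hFb : ∀ K x, |F K x| ≤ B₀)
    (hprob : ∀ K τ, IsProbabilityMeasure (ν K τ)) {D : ∀ K, ι → ΩA K → ℝ} (hDm : ∀ K τ, Measurable (D K τ))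
    {CD : ℕ → ι → ℝ} (hDb : ∀ K τ x, |D K τ x| ≤ CD K τ)
    (hpush : ∀ K τ, (ν' K τ).map (π K) = (ν K τ).tilted (D K τ)) {η : ℕ → ℝ}
    (hc : ∀ K (t : ℝ), |t| ≤ l₀ → ∀ τ ∈ T K \ Bad K t, ∀ s : ℝ, |s| ≤ l₀ → ∀ u ∈ Set.Icc (0 : ℝ) 1,
      |cov[F K, D K τ; (ν K τ).tilted fun x => s * F K x + u * D K τ x]| ≤ η K) :
    TiltedMeanMatching l₀ T Bad F ν (fun K ω => F K (π K ω)) ν' η := by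
  rw [tiltedMeanMatching_fibreBlind_iff hπ hF]
  intro K t ht τ hτ s hs
  haveI := hprob K τ
  show |tiltedMean (F K) ((ν' K τ).map (π K)) s - tiltedMean (F K) (ν K τ) s| ≤ η K
  rw [hpush K τ]
  exact abs_tiltedMean_tilted_sub_le_of_cov (hF K) (hFb K) (hDm K τ) (hDb K τ) (hc K t ht τ hτ s hs)

end Card10

/-! ## §2 The instantiation on file K's whole-measure tower (row s11): Cauchy generating functions from ONE summable scalar family -/
section Tower

variable {Ω : ℕ → Type*} [∀ K, MeasurableSpace (Ω K)] {l₀ B₀ vol : ℝ} {η : ℕ → ℝ} {CD : ℕ → ℝ}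
  {μ : ∀ K, Measure (Ω K)} {π : ∀ K, Ω (K + 1) → Ω K} {F D : ∀ K, Ω K → ℝ} {Z : ℕ → ℝ → ℝ}

/-- **THE ONE-STEP MATCHING FROM THE LAW CHANNEL** [folklore ∘ §1 + K §1].  Run laws `μ K` (probability); the first averaging `π K : Ω (K+1) → Ω K` measurable; run
`K+1`'s law PUSHES FORWARD along it to run `K`'s law tilted by the one-step log-density defect, `(μ (K+1)).map (π K) = (μ K).tilted (D K)` (`D K` measurable, bounded);
the observables of record are fibre-blind, `F (K+1) = F K ∘ π K` (`F K` measurable, `|F K| ≤ B₀`); and ONE scalar family bounds the interpolated covariances,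
`|Cov_{(μ K).tilted (s·F K + u·D K)}(F K, D K)| ≤ η K` for `|s| ≤ l₀`, `u ∈ [0,1]`.  Then `|tiltedMean (F (K+1)) (μ (K+1)) s − tiltedMean (F K) (μ K) s| ≤ η K` on `|s| ≤ l₀`. -/
theorem abs_tiltedMean_succ_sub_le_of_lawChannel (hμ : ∀ K, IsProbabilityMeasure (μ K)) (hπ : ∀ K, Measurable (π K))
    (hFm : ∀ K, Measurable (F K)) (hFb : ∀ K x, |F K x| ≤ B₀) (hFπ : ∀ K ω, F (K + 1) ω = F K (π K ω))
    (hDm : ∀ K, Measurable (D K)) (hDb : ∀ K x, |D K x| ≤ CD K) (hpush : ∀ K, (μ (K + 1)).map (π K) = (μ K).tilted (D K))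
    (hc : ∀ K (s : ℝ), |s| ≤ l₀ → ∀ u ∈ Set.Icc (0 : ℝ) 1, |cov[F K, D K; (μ K).tilted fun x => s * F K x + u * D K x]| ≤ η K)
    (K : ℕ) {s : ℝ} (hs : |s| ≤ l₀) :
    |tiltedMean (F (K + 1)) (μ (K + 1)) s - tiltedMean (F K) (μ K) s| ≤ η K := by
  haveI := hμ K
  have hcomp : F (K + 1) = (F K) ∘ π K := funext (hFπ K)
  rw [hcomp, ← tiltedMean_map (hπ K) (hFm K), hpush K]
  exact abs_tiltedMean_tilted_sub_le_of_cov (hFm K) (hFb K) (hDm K) (hDb K) (hc K s hs)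

/-- **N19's SHAPE FROM THE LAW CHANNEL** [folklore ∘ the previous theorem + gaps-ne1's `matchingModConstants_of_tiltedMeans`]: under the same hypotheses and `vol > 0`,
`T4CauchySum.MatchingModConstants vol l₀ (fun K => l₀∕vol·η K) Z` for `Z K t = mgf (F K) (μ K) t`. -/
theorem matchingModConstants_of_lawChannelTower (hvol : 0 < vol) (hμ : ∀ K, IsProbabilityMeasure (μ K)) (hπ : ∀ K, Measurable (π K))
    (hFm : ∀ K, Measurable (F K)) (hFb : ∀ K x, |F K x| ≤ B₀) (hFπ : ∀ K ω, F (K + 1) ω = F K (π K ω))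
    (hDm : ∀ K, Measurable (D K)) (hDb : ∀ K x, |D K x| ≤ CD K) (hpush : ∀ K, (μ (K + 1)).map (π K) = (μ K).tilted (D K))
    (hc : ∀ K (s : ℝ), |s| ≤ l₀ → ∀ u ∈ Set.Icc (0 : ℝ) 1, |cov[F K, D K; (μ K).tilted fun x => s * F K x + u * D K x]| ≤ η K)
    (hZ : ∀ K t, Z K t = mgf (F K) (μ K) t) :
    MatchingModConstants vol l₀ (fun K => l₀ / vol * η K) Z := by
  haveI : ∀ K, IsFiniteMeasure (μ K) := fun K => by haveI := hμ K; infer_instance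
  refine matchingModConstants_of_tiltedMeans (μ := μ) (η := η) hFm hFb hZ (fun K s hs => ?_) (fun K => le_of_eq (by field_simp))
  exact abs_tiltedMean_succ_sub_le_of_lawChannel hμ hπ hFm hFb hFπ hDm hDb hpush hc K hs

/-- **THE T⁴ CAUCHY PROPERTY FROM ONE SUMMABLE SCALAR FAMILY** [folklore ∘ the previous theorem + `T4CauchySum.cauchySeq_genFun`]: if moreover `l₀ ≥ 0` and
`Σ η K < ∞`, every generating function `K ↦ genFun Z K t`, `|t| ≤ l₀`, is Cauchy. -/
theorem cauchySeq_genFun_of_lawChannelTower (hvol : 0 < vol) (hl₀ : 0 ≤ l₀) (hμ : ∀ K, IsProbabilityMeasure (μ K)) (hπ : ∀ K, Measurable (π K))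
    (hFm : ∀ K, Measurable (F K)) (hFb : ∀ K x, |F K x| ≤ B₀) (hFπ : ∀ K ω, F (K + 1) ω = F K (π K ω))
    (hDm : ∀ K, Measurable (D K)) (hDb : ∀ K x, |D K x| ≤ CD K) (hpush : ∀ K, (μ (K + 1)).map (π K) = (μ K).tilted (D K))
    (hc : ∀ K (s : ℝ), |s| ≤ l₀ → ∀ u ∈ Set.Icc (0 : ℝ) 1, |cov[F K, D K; (μ K).tilted fun x => s * F K x + u * D K x]| ≤ η K)
    (hηs : Summable η) (hZ : ∀ K t, Z K t = mgf (F K) (μ K) t) {t : ℝ} (ht : |t| ≤ l₀) : CauchySeq fun K => genFun Z K t :=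
  cauchySeq_genFun (matchingModConstants_of_lawChannelTower hvol hμ hπ hFm hFb hFπ hDm hDb hpush hc hZ) hl₀ (hηs.mul_left _) ht

end Tower

/-! ## §3 The conditioned form: N14's located input re-pointed to (F2′) -/
section CondDefect

variable {Ω : ℕ → Type*} {m : ∀ K, MeasurableSpace (Ω K)} [mΩ : ∀ K, MeasurableSpace (Ω K)] {l₀ B₀ vol : ℝ} {CD b : ℕ → ℝ}
  {μ : ∀ K, Measure (Ω K)} {π : ∀ K, Ω (K + 1) → Ω K} {F D : ∀ K, Ω K → ℝ} {Z : ℕ → ℝ → ℝ}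

/-- **N14's LOCATED INPUT RE-POINTED: THE CONDITIONED ONE-STEP DEFECT (F2′)** [folklore ∘ §1 `abs_cov_le_of_condExp` + the previous theorem].  With the observable `F K`
measurable for a sub-σ-algebra `m K` of run `K`'s coordinates (the UNIT-FIELD σ-algebra: `F K = W_o ∘ A_K`) and, along every interpolated law
`μ_{u,s} := (μ K).tilted (s·F K + u·D K)` (`|s| ≤ l₀`, `u ∈ [0,1]`), the L¹-oscillation of the CONDITIONED defect bounded by ONE number,
`∫ |μ_{u,s}[D K | m K] − μ_{u,s}[D K]| dμ_{u,s} ≤ b K`: if `Σ b K < ∞` then the generating functions are Cauchy (`η K = B₀·b K`).  The sup-norm size `CD K` of the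
defect may be extensive — it never enters the rate. -/
theorem cauchySeq_genFun_of_condDefectTower (hvol : 0 < vol) (hl₀ : 0 ≤ l₀)
    (hμ : ∀ K, IsProbabilityMeasure (μ K)) (hπ : ∀ K, Measurable (π K)) (hm : ∀ K, m K ≤ mΩ K)
    (hFm : ∀ K, StronglyMeasurable[m K] (F K)) (hFb : ∀ K x, |F K x| ≤ B₀) (hFπ : ∀ K ω, F (K + 1) ω = F K (π K ω))
    (hDm : ∀ K, Measurable (D K)) (hDb : ∀ K x, |D K x| ≤ CD K) (hpush : ∀ K, (μ (K + 1)).map (π K) = (μ K).tilted (D K))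
    (hb : ∀ K (s : ℝ), |s| ≤ l₀ → ∀ u ∈ Set.Icc (0 : ℝ) 1,
      ∫ x, |(((μ K).tilted fun x => s * F K x + u * D K x)[D K|m K]) x -
          ∫ y, D K y ∂((μ K).tilted fun x => s * F K x + u * D K x)| ∂((μ K).tilted fun x => s * F K x + u * D K x) ≤ b K)
    (hbs : Summable b) (hZ : ∀ K t, Z K t = mgf (F K) (μ K) t) {t : ℝ} (ht : |t| ≤ l₀) : CauchySeq fun K => genFun Z K t := by
  have hFm₀ : ∀ K, Measurable (F K) := fun K => ((hFm K).mono (hm K)).measurable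
  have hB₀ : 0 ≤ B₀ := by
    haveI := hμ 0
    obtain ⟨x⟩ := nonempty_of_measure_ne_zero (μ := μ 0) (s := Set.univ) (by simp)
    exact (abs_nonneg _).trans (hFb 0 x)
  refine cauchySeq_genFun_of_lawChannelTower (η := fun K => B₀ * b K) hvol hl₀ hμ hπ hFm₀ hFb hFπ hDm hDb hpush (fun K s hs u hu => ?_)
    (hbs.mul_left B₀) hZ ht
  haveI := hμ K
  haveI : IsProbabilityMeasure ((μ K).tilted fun x => s * F K x + u * D K x) :=
    isProbabilityMeasure_tilted_of_abs_le (ν := μ K) (C := |s| * B₀ + |u| * CD K) ((measurable_const.mul (hFm₀ K)).add (measurable_const.mul (hDm K)))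
      fun x => (abs_add_le _ _).trans (add_le_add (by rw [abs_mul]; exact mul_le_mul_of_nonneg_left (hFb K x) (abs_nonneg s))
        (by rw [abs_mul]; exact mul_le_mul_of_nonneg_left (hDb K x) (abs_nonneg u)))
  exact (abs_cov_le_of_condExp (hm K) (hFm K) (hFb K) (hDm K) (hDb K)).trans (mul_le_mul_of_nonneg_left (hb K s hs u hu) hB₀)

end CondDefect

/-! ## §4 The product caricature of F2 ⇒ (F2′): the fibre-supported part of the defect is invisible, whatever its size -/
section ProductDefect

variable {U V : Type*} [MeasurableSpace U] [MeasurableSpace V] {μU : Measure U} {μV : Measure V} [IsProbabilityMeasure μU] [IsProbabilityMeasure μV]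

/-- The tilted mean of a base observable under a product law is its tilted mean under the base law. [folklore ∘ K §1 `tiltedMean_map`, Mathlib `Measure.fst_prod`] -/
theorem tiltedMean_comp_fst_prod {ν : Measure U} {ν' : Measure V} [IsProbabilityMeasure ν'] {F : U → ℝ} (hF : Measurable F) (s : ℝ) :
    tiltedMean (fun p : U × V => F p.1) (ν.prod ν') s = tiltedMean F ν s := by
  have h := tiltedMean_map (μ := ν.prod ν') measurable_fst hF s
  rw [← Measure.fst, Measure.fst_prod] at h
  exact h.symm

variable {F dU : U → ℝ} {dV : V → ℝ} {B₀ δU CV : ℝ}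

/-- **THE FIBRE-SUPPORTED PART OF THE ONE-STEP DEFECT IS INVISIBLE** [folklore ∘ §4 + J §1] — the product caricature of F2 ⇒ (F2′).  Run A `= μU ⊗ μV` (unit field `u`
INDEPENDENT of the fluctuations `v`), run B's push-forward `= (μU ⊗ μV).tilted (dU ⊕ dV)` with a defect that SPLITS into a unit-field part `dU` (`|dU| ≤ δU`) and a
fluctuation part `dV` (bounded measurable, of ANY size `CV` — extensive or not), observable `F ∘ fst` fibre-blind (`|F| ≤ B₀`).  Then for every `s`:
`|tiltedMean (F ∘ fst) ((μU ⊗ μV).tilted (dU ⊕ dV)) s − tiltedMean (F ∘ fst) (μU ⊗ μV) s| ≤ B₀·(e^{2δU} − 1)` — `dV` does not enter.  (With cross terms the unit-field part is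
replaced by the CONDITIONED defect: §3.) -/
theorem abs_tiltedMean_prodTilted_sub_le_of_baseDefect (hFm : Measurable F) (hFb : ∀ u, |F u| ≤ B₀) (hdUm : Measurable dU) (hdUb : ∀ u, |dU u| ≤ δU)
    (hdVm : Measurable dV) (hdVb : ∀ v, |dV v| ≤ CV) (s : ℝ) :
    |tiltedMean (fun p : U × V => F p.1) ((μU.prod μV).tilted fun p => dU p.1 + dV p.2) s -
        tiltedMean (fun p : U × V => F p.1) (μU.prod μV) s| ≤ B₀ * (Real.exp (2 * δU) - 1) := by
  haveI : IsProbabilityMeasure (μV.tilted dV) := isProbabilityMeasure_tilted_of_abs_le hdVm hdVb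
  rw [YMDAG.N14.VarianceInfluence.tilted_prod_add μU μV hdUm hdVm, tiltedMean_comp_fst_prod (ν := μU.tilted dU) (ν' := μV.tilted dV) hFm,
    tiltedMean_comp_fst_prod (ν := μU) (ν' := μV) hFm]
  exact YMDAG.N14.ConvexFibreConsistency.abs_tiltedMean_tilted_sub_le (μ := μU) hdUm hdUb hFm hFb s

end ProductDefect

end YMDAG.N14.LawChannel

end
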